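import Literature.Algebra.Lie.LefschetzDomainSpan
import Literature.Algebra.Lie.Sl2CoupledTriples
import Literature.Algebra.Lie.LefschetzModuleJordanType
import HarnessLib

/-!
# Looijenga–Lunts (2.1) (ii) ⟹ (i): the subspace `V`, its stability, and the reduction to one bracket identity

[cite: LooijengaLunts1997, §2 (2.1) p. 9 L79–L106] (E. Looijenga, V. Lunts, *A Lie algebra attached to a projective
variety*, Invent. Math. 129 (1997); held text `paper:arxiv-alg-geom_9604014`, p0009).  Lane `lit-hodgefound`, seat
A1, rows A1-115 (§1–§4), A1-116/A1-117 (§5) of `run/shared/lean/pub/lit-hodgefound/SKELETON.md`.  PROVED theorems only (no definition, no named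
fact, no `sorry`; D-0026 net debt `0`).

VERBATIM, (2.1): "Let `M` be a Lefschetz `𝔞`-module. Then the following two properties are equivalent (i) The graded
Lie algebra `𝔤(𝔞, M)` has degrees `-2`, `0` and `2` only. (ii) The operators `f_a` with `a ∈ 𝔞` in the domain of
`f`, mutually commute.  Proof. We only prove the nontrivial implication (ii) ⟹ (i). Write `𝔤` for `𝔤(𝔞, M)`. If
`a ∈ 𝔞` is such that `f_a` is defined, then regard `𝔤` as an `𝔰𝔩(2)`-module via the `𝔰𝔩(2)`-triple `(e_a, h, f_a)`
and let `V(a) ⊂ 𝔤` be sum of the irreducible summands of dimension `1` and `3`. Notice that `V(a)` contains the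
image of `𝔞`. So the intersection `V` of the `V(a)`'s also contains the image of `𝔞`. We have
`V = V₋₂ ⊕ V₀ ⊕ V₂` where `V_{2k}` can be characterized as the subspace of `𝔤_{2k}` that is annihilated by all
the operators `ad^{-k+2}(e_a)`, or alternatively, by all the operators `ad^{k+2}(f_a)`. Since the operators `e_a`
resp. `f_a` mutually commute it follows that `V` is invariant under these operators. Hence `V = 𝔤` and so `𝔤` has
degrees `-2`, `0` and `2` only."

WHAT THIS FILE PROVES, for a Lefschetz triple `(𝔤, h, 𝔞)` (A1-84 `IsLefschetzTriple`; the module statement is the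
case `𝔤 = 𝔤(𝔞, M)`, A1-101 `IsLefschetzModule.isLefschetzTriple`), with `U = dom f ⊆ 𝔞` (`lefschetzDomain`) and
`f(U)` (`lefschetzDuals`):
* §1 **polynomial identities with vector coefficients** (`eq_zero_of_forall_sum_pow_smul_eq_zero`: a polynomial
  `∑ tⁱ cᵢ` with coefficients in a vector space vanishing at infinitely many `t` has all `cᵢ = 0`) and **`U` is open
  along lines in a triple** (`IsLefschetzTriple.finite_setOf_add_smul_not_mem_lefschetzDomain`, A1-111 transported
  through the adjoint Lefschetz module of A1-101) — whence the printed tool "polarisation": if `(ad c)ⁿ v = 0` for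
  all `c ∈ U` then `(ad a)ᵐ (ad c)ⁿ⁻ᵐ v = 0` for all `a ∈ 𝔞`, `c ∈ U` (`IsLefschetzTriple.pow_ad_pow_ad_eq_zero`).
* §2 **pointwise `𝔰𝔩₂`** in a finite-dimensional Lie algebra: for `w` of weight `0`, `[e,[e,w]] = 0 ↔ [f,[f,w]] = 0`
  (`lie_f_lie_f_eq_zero_of_lie_e_lie_e`, its mirror), and then `2[f,w] = [f,[f,[e,w]]]` (`two_nsmul_lie_f_eq`).
* §3 **the `e`-side of the printed argument, which is correct as printed**: `V₋₂ := C_{𝔤₋₂}(f(U))` satisfies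
  `[𝔞, [𝔞, [𝔞, V₋₂]]] = 0` (`IsLefschetzTriple.lie_lie_lie_eq_zero_of_forall_dual`: a vector of `V₋₂` is a lowest
  weight vector of weight `-2` for every `(e_c, h, f_c)`, `c ∈ U`, so `(ad e_c)³` kills it; polarise; `U` spans `𝔞`),
  i.e. `ad(𝔞) V₋₂ ⊆ V₀ := {w ∈ 𝔤₀ : [𝔞,[𝔞,w]] = 0}`, and trivially `ad(𝔞) V₀ ⊆ V₂ := C_{𝔤₂}(𝔞)`, `ad(𝔞) V₂ = 0`.
  Under (ii): `f(U) ⊆ V₋₂`, so **`[a, [a', [a'', f_b]]] = 0` for all `a, a', a'' ∈ 𝔞`, `b ∈ U`**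
  (`IsLefschetzTriple.lie_lie_lie_dual_eq_zero`) — every `f_b` spans a `V(2)` under every `e_a` and all the mixed
  cubic expressions vanish; in particular the degree-`2` elements `[e_a, [e_a, f_b]]` of A1-114 CENTRALISE `𝔞`
  (`IsLefschetzTriple.lie_adTwo_dual_eq_zero`), and dually `[f_c, [f_a, [f_a, b]]] = 0`
  (`IsLefschetzTriple.dual_lie_adTwo_eq_zero`).
* §4 **the `f`-side, reduced to ONE identity.**  The printed sentence "Since the operators … f_a mutually commute it
  follows that V is invariant" does not follow for the `f_a` (the characterisation of `V₂ = C_{𝔤₂}(𝔞)` is by the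
  `e`'s, and `f(U)` is not Zariski-dense in its span: Looijenga–Lunts' own (4.5) avoids (2.1)).  We isolate exactly
  what is needed: **CRUX `(**)`: for `a ∈ U`, `f_b ∈ f(U)` and `x ∈ C_{𝔤₂}(𝔞)`, `[[a, [a, f_b]], x] = 0`** — the
  elements `[e_a,[e_a,f_b]] ∈ C_{𝔤₂}(𝔞)` (§3) should centralise `C_{𝔤₂}(𝔞)`.  THEOREM
  (`IsLefschetzTriple.adDegree_four_eq_bot_of_crux`): **(ii) ∧ (**) ⟹ 𝔤₄ = 0**, hence `(𝔤, h)` is a Jordan–Lefschetz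
  pair (`IsLefschetzTriple.isJordanLefschetzPair_of_crux`, via A1-104); conversely (i) ⟹ (ii) ∧ (**) trivially, so
  **(i) ⟺ (ii) ∧ (**)** (`IsLefschetzTriple.isJordanLefschetzPair_iff_dual_comm_and_crux`).  The proof of the theorem
  is the printed one made honest: with (**), `ad(f_b) V₂ ⊆ V₀` (Jacobi turns `(ad c)²[f_b, x]` into `[[c,[c,f_b]], x]`,
  then polarise), `ad(f_b) V₀ ⊆ V₋₂` (§2: `2[f_b, w] = [f_b,[f_b,[b, w]]]` and the `f`'s commute), `ad(f_b) V₋₂ = 0`;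
  so `V = V₋₂ + V₀ + V₂` is stable under the generators `𝔞 ∪ f(U)` of `𝔤`, hence an ideal containing them, hence
  `V = 𝔤` and `𝔤₄ = 0`.
* §5 **the subspace criterion and (2.1) FOR SATURATED TRIPLES** (row A1-116).  Running the argument of §4 on an
  abelian subspace `𝔟 ⊇ 𝔞` of `𝔤₂` instead of `𝔞` — with `V₂ = C_{𝔤₂}(𝔟)`, `V₀ = {w : (ad x)² w = 0 ∀ x ∈ 𝔟}`,
  `V₋₂ = {y : (ad x)³ y = 0 ∀ x ∈ 𝔟}`, so that the `e`-side is polarisation over the SPACE `𝔟` and the `f`-side is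
  Leibniz — gives `IsLefschetzTriple.adDegree_four_eq_bot_of_subspace`: **if `(ad x)³ f_b = 0` and
  `(ad x)² f_b ∈ 𝔟` for all `x ∈ 𝔟` and all partners `f_b`, then `𝔤₄ = 0`**; conversely `𝔟 = 𝔤₂` works when
  `𝔤₄ = 0` (`…isJordanLefschetzPair_iff_exists_subspace`).  With `𝔟 = 𝔞`: under (ii), `𝔤₄ = 0` as soon as `𝔞`
  is closed under `x ↦ (ad x)² f_b` (`…adDegree_four_eq_bot_of_lie_lie_dual_mem`); and since `(ad x)² f_b`
  commutes with `𝔞` (§3), `(𝔤, h, 𝔞 + K (ad x)² f_b)` is again a Lefschetz triple (`…sup_span_singleton`), whence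
  **`IsLefschetzTriple.isJordanLefschetzPair_of_isSaturated`: a SATURATED Lefschetz triple ("`𝔞` maximal",
  p. 7 L78–L82) satisfying (ii) is Jordan–Lefschetz** — Looijenga–Lunts (2.1) (ii) ⟹ (i) for saturated triples,
  proved in full; `…isSaturated_iff_forall_mem` (saturated ⟺ self-centralising in `𝔤₂`), `…exists_isSaturated`,
  and the PAIR form `isJordanLefschetzPair_iff_exists_isSaturated`: **a Lefschetz pair is Jordan–Lefschetz iff a
  saturated associated triple has commuting partners** (row A1-117).
SCOPE.  For a NON-saturated `𝔞` the implication (ii) ⟹ (i) is reduced to (**) / to the subspace criterion but NOT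
proved here ((ii) need not pass to a saturation of `𝔞`); it holds when `dim 𝔞 ≤ 2` by the Chevalley–Serre
relations of A1-114 and the Gabber–Kac theorem (Kac, Thm 9.11 — not in the tree), and in every Jordan/loop model.
The skeleton's validation instances: tori `E × E′` (V-A1-114d) and the `M₃(ℚ)⁺` module of the seat notes, where
`𝔤 = 𝔰𝔩₆` is `3`-graded and (**) is visible.
-/

namespace Literature.Algebra.Lie

open Set LieAlgebra LieModule

/-! ## §1 Polynomial identities with vector coefficients; `dom f` is open along lines -/

section PolyIdentity

variable {K : Type*} [Field K] {V : Type*} [AddCommGroup V] [Module K V]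

/-- **A polynomial with vector coefficients vanishing at infinitely many scalars is zero**: if
`∑_{i<n} tⁱ • cᵢ = 0` for all `t` in an infinite `S ⊆ K` then every `cᵢ = 0` (apply linear forms and use that a
nonzero polynomial over a field has finitely many roots) — the algebra behind "the set of `a ∈ 𝔞` with the
Lefschetz property is always Zariski open in `𝔞`" and the polarisation step of (2.1).
[cite: LooijengaLunts1997, §1 (1.1) p. 4 L28–L35, §2 (2.1) p. 9 L104 ("it follows that V is invariant")] -/
theorem eq_zero_of_forall_sum_pow_smul_eq_zero {n : ℕ} {c : ℕ → V} {S : Set K} (hS : S.Infinite)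
    (h0 : ∀ t ∈ S, ∑ i ∈ Finset.range n, t ^ i • c i = 0) {i : ℕ} (hi : i < n) : c i = 0 := by
  rw [← Module.forall_dual_apply_eq_zero_iff K (c i)]
  intro φ
  set p : Polynomial K := ∑ j ∈ Finset.range n, Polynomial.monomial j (φ (c j)) with hp
  have hroot : S ⊆ {t | p.IsRoot t} := fun t ht ↦ by
    rw [Set.mem_setOf_eq, Polynomial.IsRoot, hp, Polynomial.eval_finsetSum]
    have h1 := congr_arg φ (h0 t ht)
    rw [map_sum, map_zero] at h1
    rw [← h1]
    refine Finset.sum_congr rfl fun j _ ↦ ?_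
    rw [Polynomial.eval_monomial, map_smul, smul_eq_mul, mul_comm]
  have hp0 : p = 0 := Polynomial.eq_zero_of_infinite_isRoot p (hS.mono hroot)
  have h2 := congr_arg (fun q : Polynomial K ↦ q.coeff i) hp0
  simp only [hp, Polynomial.finsetSum_coeff, Polynomial.coeff_monomial, Polynomial.coeff_zero,
    Finset.sum_ite_eq', Finset.mem_range, if_pos hi] at h2
  exact h2

end PolyIdentity

section Lines

variable {K : Type*} [Field K] [CharZero K] {L : Type*} [LieRing L] [LieAlgebra K L] [FiniteDimensional K L]
  {h : L} {𝔞 : Submodule K L}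

/-- **In a Lefschetz triple the domain of `f` is open along lines**: for `a ∈ dom f` and `b ∈ 𝔞`, `a + t b ∈ dom f`
for all but finitely many `t ∈ K` (A1-111 for the adjoint Lefschetz module `(ad 𝔞, 𝔤)` of A1-101: `ad(a + t b)` has
the Lefschetz property for cofinitely many `t`, and its partner in `𝔤𝔩(𝔤)` comes from `𝔤`).
[cite: LooijengaLunts1997, §1 (1.1) p. 4 L28–L35 ("Zariski open in 𝔞"), p. 7 L61–L64] -/
theorem IsLefschetzTriple.finite_setOf_add_smul_not_mem_lefschetzDomain (T : IsLefschetzTriple K h 𝔞) {a b : L}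
    (ha : a ∈ lefschetzDomain K h 𝔞) (hb : b ∈ 𝔞) : {t : K | a + t • b ∉ lefschetzDomain K h 𝔞}.Finite := by
  haveI := T.isSemisimple
  have La : HasLefschetzProperty (ad K L h) (ad K L a) := T.hasLefschetzProperty_ad ha
  have hbdeg : ∀ k : ℤ, MapsTo (ad K L b) (degreeSpace (ad K L h) k) (degreeSpace (ad K L h) (k + 2)) := by
    intro k x hx
    rw [SetLike.mem_coe, ← adDegree_intCast_eq_degreeSpace] at hx ⊢
    rw [Int.cast_add, Int.cast_two, ad_apply, add_comm]
    exact lie_mem_adDegree (T.le_adDegree_two hb) hx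
  have hab : Commute (ad K L a) (ad K L b) := by
    change ad K L a * ad K L b = ad K L b * ad K L a
    refine LinearMap.ext fun x ↦ ?_
    rw [Module.End.mul_apply, Module.End.mul_apply, ad_apply, ad_apply, ad_apply, ad_apply]
    have h1 := leibniz_lie a b x
    rw [T.lie_eq_zero a ha.1 b hb, zero_lie, zero_add] at h1
    exact h1
  obtain ⟨e₀, f₀, t₀⟩ := T.isSimpleElement
  have h0 : ad K L h ≠ 0 := fun h0 ↦ by
    have h1 : (2 : K) • e₀ = 0 := by rw [← t₀.lie_h_e_smul K, ← ad_apply (R := K), h0, LinearMap.zero_apply]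
    exact t₀.e_ne_zero ((smul_eq_zero.1 h1).resolve_left two_ne_zero)
  refine (La.finite_setOf_not_hasLefschetzProperty_add_smul hbdeg hab).subset fun t ht ↦ ?_
  rw [Set.mem_setOf_eq] at ht ⊢
  intro Lt
  apply ht
  refine ⟨add_mem ha.1 (Submodule.smul_mem _ t hb), ?_⟩
  have Lt' : HasLefschetzProperty (ad K L h) (ad K L (a + t • b)) := by rwa [map_add, map_smul]
  obtain ⟨F, tF⟩ := Lt'.exists_isSl2Triple T.isZGrading_ad h0
  obtain ⟨f, tf, -⟩ := exists_isSl2Triple_of_isSl2Triple_toEnd (L := L) (M := L) tF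
  exact ⟨f, tf⟩

/-- Hence, `K` being infinite, **the set of `t` with `a + t b ∈ dom f` is infinite**.
[cite: LooijengaLunts1997, §1 (1.1) p. 4 L28–L35] -/
theorem IsLefschetzTriple.infinite_setOf_add_smul_mem_lefschetzDomain (T : IsLefschetzTriple K h 𝔞) {a b : L}
    (ha : a ∈ lefschetzDomain K h 𝔞) (hb : b ∈ 𝔞) : {t : K | a + t • b ∈ lefschetzDomain K h 𝔞}.Infinite := by
  haveI : Infinite K := Infinite.of_injective _ Nat.cast_injective
  have h1 := (T.finite_setOf_add_smul_not_mem_lefschetzDomain ha hb).infinite_compl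
  refine h1.mono fun t ht ↦ ?_
  rwa [Set.mem_compl_iff, Set.mem_setOf_eq, not_not] at ht

omit [CharZero K] [FiniteDimensional K L] in
/-- `(ad x)ⁿ` written out: `((ad x)^(n+1)) v = [x, ((ad x)^n) v]`. [folklore] -/
private theorem ad_pow_succ_apply (x v : L) (n : ℕ) : ((ad K L x) ^ (n + 1)) v = ⁅x, ((ad K L x) ^ n) v⁆ := by
  rw [pow_succ', Module.End.mul_apply, ad_apply]

omit [FiniteDimensional K L] in
/-- **Reading off coefficients along a line.**  If `[a, c] = 0` and `(ad(c + t a))ⁿ v = 0` for all `t` in an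
infinite set `S`, then `(ad a)ᵐ (ad c)ⁿ⁻ᵐ v = 0` for every `m ≤ n`: expand `(t • ad a + ad c)ⁿ` binomially
(`ad a`, `ad c` commute) and read off the coefficient of `tᵐ`, which is `(n choose m) (ad a)ᵐ (ad c)ⁿ⁻ᵐ v` (§1).
[cite: LooijengaLunts1997, §2 (2.1) p. 9 L100–L105 ("annihilated by all the operators ad^{-k+2}(e_a) … it follows that V is invariant")] -/
theorem pow_ad_pow_ad_eq_zero_of_infinite {c a : L} (hac : ⁅a, c⁆ = 0) {n : ℕ} {v : L} {S : Set K}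
    (hS : S.Infinite) (hv : ∀ t ∈ S, ((ad K L (c + t • a)) ^ n) v = 0) {m : ℕ} (hm : m ≤ n) :
    ((ad K L a) ^ m) (((ad K L c) ^ (n - m)) v) = 0 := by
  set A : Module.End K L := ad K L a with hA
  set C : Module.End K L := ad K L c with hC
  have hAC : Commute A C := by
    change A * C = C * A
    refine LinearMap.ext fun x ↦ ?_
    rw [hA, hC, Module.End.mul_apply, Module.End.mul_apply, ad_apply, ad_apply, ad_apply, ad_apply]
    have h1 := leibniz_lie a c x
    rw [hac, zero_lie, zero_add] at h1
    exact h1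
  -- the coefficients of `t ↦ (ad (c + t a))ⁿ v`
  set coef : ℕ → L := fun k ↦ (A ^ k * C ^ (n - k) * (n.choose k : Module.End K L)) v with hcoef
  have hexp : ∀ t : K, ((ad K L (c + t • a)) ^ n) v = ∑ k ∈ Finset.range (n + 1), t ^ k • coef k := by
    intro t
    have h1 : ad K L (c + t • a) = t • A + C := by rw [map_add, map_smul, add_comm]
    rw [h1, (hAC.smul_left t).add_pow, LinearMap.sum_apply]
    refine Finset.sum_congr rfl fun k _ ↦ ?_
    rw [hcoef, smul_pow, smul_mul_assoc, smul_mul_assoc, LinearMap.smul_apply]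
  have hzero : ∀ t ∈ S, ∑ k ∈ Finset.range (n + 1), t ^ k • coef k = 0 := fun t ht ↦ by rw [← hexp t]; exact hv t ht
  have h2 := eq_zero_of_forall_sum_pow_smul_eq_zero hS hzero (i := m) (by omega)
  rw [hcoef] at h2
  simp only [Module.End.mul_apply, Module.End.natCast_apply, map_nsmul] at h2
  rw [← Nat.cast_smul_eq_nsmul K, smul_eq_zero] at h2
  exact h2.resolve_left (Nat.cast_ne_zero.2 (Nat.choose_pos hm).ne')

/-- **Polarisation along lines.**  If `(ad c')ⁿ v = 0` for every `c' ∈ dom f`, then for `c ∈ dom f`, `a ∈ 𝔞` and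
`m ≤ n`: `(ad a)ᵐ (ad c)ⁿ⁻ᵐ v = 0` — the line `c + t a` lies in `dom f` for infinitely many `t`.
[cite: LooijengaLunts1997, §2 (2.1) p. 9 L100–L105, §1 (1.1) p. 4 L28–L35] -/
theorem IsLefschetzTriple.pow_ad_pow_ad_eq_zero (T : IsLefschetzTriple K h 𝔞) {n : ℕ} {v : L}
    (hv : ∀ c' ∈ lefschetzDomain K h 𝔞, ((ad K L c') ^ n) v = 0) {c a : L} (hc : c ∈ lefschetzDomain K h 𝔞)
    (ha : a ∈ 𝔞) {m : ℕ} (hm : m ≤ n) : ((ad K L a) ^ m) (((ad K L c) ^ (n - m)) v) = 0 :=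
  pow_ad_pow_ad_eq_zero_of_infinite (T.lie_eq_zero a ha c hc.1) (T.infinite_setOf_add_smul_mem_lefschetzDomain hc ha)
    (fun _ ht ↦ hv _ ht) hm

omit [FiniteDimensional K L] in
/-- **Polarisation over an abelian subspace `𝔟`**: if `(ad x)ⁿ v = 0` for all `x ∈ 𝔟` then
`(ad x')ᵐ (ad x)ⁿ⁻ᵐ v = 0` for all `x, x' ∈ 𝔟` (the whole line `x + t x'` lies in `𝔟`).
[cite: LooijengaLunts1997, §2 (2.1) p. 9 L100–L105] -/
theorem pow_ad_pow_ad_eq_zero_of_forall_mem {𝔟 : Submodule K L} (h𝔟 : ∀ x ∈ 𝔟, ∀ y ∈ 𝔟, ⁅x, y⁆ = 0) {n : ℕ}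
    {v : L} (hv : ∀ x ∈ 𝔟, ((ad K L x) ^ n) v = 0) {x x' : L} (hx : x ∈ 𝔟) (hx' : x' ∈ 𝔟) {m : ℕ}
    (hm : m ≤ n) : ((ad K L x') ^ m) (((ad K L x) ^ (n - m)) v) = 0 :=
  haveI : Infinite K := Infinite.of_injective _ Nat.cast_injective
  pow_ad_pow_ad_eq_zero_of_infinite (h𝔟 x' hx' x hx) Set.infinite_univ
    (fun t _ ↦ hv _ (add_mem hx (Submodule.smul_mem _ t hx'))) hm

omit [CharZero K] [FiniteDimensional K L] in
/-- Polar form of a vanishing quadratic expression: if `[a, [a, z]] = 0` for all `a` in the abelian `𝔞` then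
`[a, [a', z]] = 0` for all `a, a' ∈ 𝔞` (characteristic `≠ 2`). [cite: LooijengaLunts1997, §2 (2.1) p. 9 L104] -/
theorem lie_lie_eq_zero_of_forall_lie_lie_self [CharZero K] (h𝔞 : ∀ a ∈ 𝔞, ∀ b ∈ 𝔞, ⁅a, b⁆ = 0) {z : L}
    (hz : ∀ a ∈ 𝔞, ⁅a, ⁅a, z⁆⁆ = 0) {a a' : L} (ha : a ∈ 𝔞) (ha' : a' ∈ 𝔞) : ⁅a, ⁅a', z⁆⁆ = 0 := by
  have hcomm : ⁅a', ⁅a, z⁆⁆ = ⁅a, ⁅a', z⁆⁆ := by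
    have h1 := leibniz_lie a' a z
    rw [h𝔞 a' ha' a ha, zero_lie, zero_add] at h1
    exact h1
  have h2 := hz (a + a') (add_mem ha ha')
  rw [add_lie, add_lie, lie_add, lie_add, hz a ha, hz a' ha', zero_add, add_zero, hcomm, ← two_nsmul,
    ← Nat.cast_smul_eq_nsmul K, smul_eq_zero] at h2
  exact h2.resolve_left (Nat.cast_ne_zero.2 two_ne_zero)

end Lines

/-! ## §2 Pointwise `𝔰𝔩₂`: weight-`0` vectors killed by `(ad e)²` -/

section Jacobi

variable {L : Type*} [LieRing L] {h e f : L}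

/-- For `w` of weight `0` with `[f, [f, w]] = 0`: **`2[f, w] = [f, [f, [e, w]]]`** (pure Jacobi).
[cite: LooijengaLunts1997, §2 (2.1) p. 9 L103–L105] -/
theorem two_nsmul_lie_f_eq (t : IsSl2Triple h e f) {w : L} (hw : ⁅h, w⁆ = 0) (hffw : ⁅f, ⁅f, w⁆⁆ = 0) :
    2 • ⁅f, w⁆ = ⁅f, ⁅f, ⁅e, w⁆⁆⁆ := by
  have h1 : ⁅f, ⁅e, w⁆⁆ = ⁅e, ⁅f, w⁆⁆ := by
    rw [leibniz_lie f e, ← lie_skew f e, t.lie_e_f, neg_lie, hw, neg_zero, zero_add]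
  have h2 : ⁅h, ⁅f, w⁆⁆ = -(2 • ⁅f, w⁆) := by
    rw [leibniz_lie h f, t.lie_h_f_nsmul, hw, lie_zero, add_zero, neg_lie, nsmul_lie]
  rw [h1, leibniz_lie f e, ← lie_skew f e, t.lie_e_f, neg_lie, h2, neg_neg, hffw, lie_zero, add_zero]

/-- Jacobi: if `[c, x] = 0` then `[[c, [c, f]], x] = [c, [c, [f, x]]]` — the bracket of A1-114's `[e_c, [e_c, f_b]]`
with a vector centralised by `c` is `(ad c)² [f_b, x]`. [cite: LooijengaLunts1997, §2 (2.1) p. 9 L100–L105] -/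
theorem lie_adTwo_eq_of_lie_eq_zero {c f x : L} (hcx : ⁅c, x⁆ = 0) :
    ⁅⁅c, ⁅c, f⁆⁆, x⁆ = ⁅c, ⁅c, ⁅f, x⁆⁆⁆ := by
  rw [lie_lie c ⁅c, f⁆ x, hcx, lie_zero, sub_zero, lie_lie c f x, hcx, lie_zero, sub_zero]

/-- Leibniz, twice: `(ad x)² [f, m] = [(ad x)² f, m] + 2[(ad x) f, (ad x) m] + [f, (ad x)² m]`. [folklore] -/
private theorem ad_sq_lie (x f m : L) :
    ⁅x, ⁅x, ⁅f, m⁆⁆⁆ = ⁅⁅x, ⁅x, f⁆⁆, m⁆ + 2 • ⁅⁅x, f⁆, ⁅x, m⁆⁆ + ⁅f, ⁅x, ⁅x, m⁆⁆⁆ := by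
  rw [leibniz_lie x f m, lie_add, leibniz_lie x ⁅x, f⁆ m, leibniz_lie x f ⁅x, m⁆, two_nsmul]
  abel

/-- Leibniz, three times: `(ad x)³ [f, m] = [(ad x)³ f, m] + 3[(ad x)² f, (ad x) m] + 3[(ad x) f, (ad x)² m] +
[f, (ad x)³ m]`. [folklore] -/
private theorem ad_cube_lie (x f m : L) :
    ⁅x, ⁅x, ⁅x, ⁅f, m⁆⁆⁆⁆ = ⁅⁅x, ⁅x, ⁅x, f⁆⁆⁆, m⁆ + 3 • ⁅⁅x, ⁅x, f⁆⁆, ⁅x, m⁆⁆ + 3 • ⁅⁅x, f⁆, ⁅x, ⁅x, m⁆⁆⁆ +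
      ⁅f, ⁅x, ⁅x, ⁅x, m⁆⁆⁆⁆ := by
  rw [ad_sq_lie x f m, lie_add, lie_add, lie_nsmul, leibniz_lie x ⁅x, ⁅x, f⁆⁆ m, leibniz_lie x ⁅x, f⁆ ⁅x, m⁆,
    leibniz_lie x f ⁅x, ⁅x, m⁆⁆]
  abel

end Jacobi

section Sl2Pointwise

variable (K : Type*) [Field K] [CharZero K] {L : Type*} [LieRing L] [LieAlgebra K L] [FiniteDimensional K L]
  {h e f : L}

include K

/-- A weight-`0` vector killed by `e` is killed by `f` (it spans a trivial `𝔰𝔩₂`-module).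
[cite: LooijengaLunts1997, §2 (2.1) p. 9 L100–L102 ("annihilated by … ad^{-k+2}(e_a), or alternatively, by … ad^{k+2}(f_a)", k = 0)] -/
theorem lie_f_eq_zero_of_lie_e_eq_zero (t : IsSl2Triple h e f) {w : L} (hw : ⁅h, w⁆ = 0) (hew : ⁅e, w⁆ = 0) :
    ⁅f, w⁆ = 0 := by
  by_cases hw0 : w = 0
  · rw [hw0, lie_zero]
  · have P : t.HasPrimitiveVectorWith (M := L) w ((0 : ℕ) : K) :=
      { ne_zero := hw0
        lie_h := by rw [hw, Nat.cast_zero, zero_smul]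
        lie_e := hew }
    have h1 := P.pow_toEnd_f_eq_zero_of_eq_nat (n := 0) rfl
    simpa only [zero_add, pow_one, LieModule.toEnd_apply_apply] using h1

/-- **For `w` of weight `0`: `[e, [e, w]] = 0` implies `[f, [f, w]] = 0`** (`w` lies in the sum of the
`𝔰𝔩₂`-summands of dimension `1` and `3`): `v = [e, w]` is a highest weight vector of weight `2`, `2w - [f, v]` is a
weight-`0` vector killed by `e`, hence by `f`, so `2[f, w] = [f, [f, v]]` and `2[f,[f,w]] = (ad f)³ v = 0`.
[cite: LooijengaLunts1997, §2 (2.1) p. 9 L100–L102 ("V_{2k} can be characterized as the subspace of 𝔤_{2k} that is annihilated by all the operators ad^{-k+2}(e_a), or alternatively, by all the operators ad^{k+2}(f_a)")] -/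
theorem lie_f_lie_f_eq_zero_of_lie_e_lie_e (t : IsSl2Triple h e f) {w : L} (hw : ⁅h, w⁆ = 0)
    (heew : ⁅e, ⁅e, w⁆⁆ = 0) : ⁅f, ⁅f, w⁆⁆ = 0 := by
  have hhv : ⁅h, ⁅e, w⁆⁆ = 2 • ⁅e, w⁆ := by
    rw [leibniz_lie, t.lie_h_e_nsmul, hw, lie_zero, add_zero, nsmul_lie]
  have hfffv : ⁅f, ⁅f, ⁅f, ⁅e, w⁆⁆⁆⁆ = 0 := lie_f_lie_f_lie_f_eq_zero_of_lie_e K t heew hhv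
  have hefv : ⁅e, ⁅f, ⁅e, w⁆⁆⁆ = 2 • ⁅e, w⁆ := by
    rw [leibniz_lie e f, t.lie_e_f, hhv, heew, lie_zero, add_zero]
  have hhfv : ⁅h, ⁅f, ⁅e, w⁆⁆⁆ = 0 := by
    rw [leibniz_lie h f, t.lie_h_f_nsmul, hhv, neg_lie, nsmul_lie, lie_nsmul, neg_add_cancel]
  -- `w₀ = 2w - [f, v]` is killed by `e` and has weight `0`
  have hw₀ : ⁅f, 2 • w - ⁅f, ⁅e, w⁆⁆⁆ = 0 := by
    refine lie_f_eq_zero_of_lie_e_eq_zero K t ?_ ?_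
    · rw [lie_sub, lie_nsmul, hw, nsmul_zero, hhfv, sub_zero]
    · rw [lie_sub, lie_nsmul, hefv, sub_self]
  rw [lie_sub, lie_nsmul, sub_eq_zero] at hw₀
  have h2 : 2 • ⁅f, ⁅f, w⁆⁆ = 0 := by rw [← lie_nsmul, hw₀, hfffv]
  rw [← Nat.cast_smul_eq_nsmul K, smul_eq_zero] at h2
  exact h2.resolve_left (Nat.cast_ne_zero.2 two_ne_zero)

/-- Mirror: for `w` of weight `0`, `[f, [f, w]] = 0` implies `[e, [e, w]] = 0`. [cite: LooijengaLunts1997, §2 (2.1) p. 9 L100–L102] -/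
theorem lie_e_lie_e_eq_zero_of_lie_f_lie_f (t : IsSl2Triple h e f) {w : L} (hw : ⁅h, w⁆ = 0)
    (hffw : ⁅f, ⁅f, w⁆⁆ = 0) : ⁅e, ⁅e, w⁆⁆ = 0 :=
  lie_f_lie_f_eq_zero_of_lie_e_lie_e K t.symm (by rw [neg_lie, hw, neg_zero]) hffw

/-- **The crux in Looijenga–Lunts' alternative language** ("annihilated by … the operators `ad^{k+2}(f_a)`"): for
`x` centralised by `a` with `[f_b, x]` of weight `0`, `[[a, [a, f_b]], x] = 0 ↔ (ad f_a)² (ad f_b) x = 0`, where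
`f_a` is the partner of `a` (§2 applied to the weight-`0` vector `[f_b, x]`). [cite: LooijengaLunts1997, §2 (2.1) p. 9 L100–L102] -/
theorem lie_adTwo_lie_eq_zero_iff {a fa fb x : L} (ta : IsSl2Triple h a fa) (hax : ⁅a, x⁆ = 0)
    (hw : ⁅h, ⁅fb, x⁆⁆ = 0) : ⁅⁅a, ⁅a, fb⁆⁆, x⁆ = 0 ↔ ⁅fa, ⁅fa, ⁅fb, x⁆⁆⁆ = 0 := by
  rw [lie_adTwo_eq_of_lie_eq_zero hax]
  exact ⟨lie_f_lie_f_eq_zero_of_lie_e_lie_e K ta hw, lie_e_lie_e_eq_zero_of_lie_f_lie_f K ta hw⟩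

end Sl2Pointwise


/-! ## §3 The `e`-side: `[𝔞, [𝔞, [𝔞, V₋₂]]] = 0`; under (ii) the partners lie in `V₋₂` -/

section ESide

variable {K : Type*} [Field K] [CharZero K] {L : Type*} [LieRing L] [LieAlgebra K L] [FiniteDimensional K L]
  {h : L} {𝔞 : Submodule K L}

/-- **`V₋₂ = C_{𝔤₋₂}(f(dom f))` is killed by all cubic expressions in `𝔞`**: if `y ∈ 𝔤₋₂` commutes with every
partner `f_c`, `c ∈ dom f`, then `[a, [a', [a'', y]]] = 0` for all `a, a', a'' ∈ 𝔞` — `y` is a lowest weight vector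
of weight `-2` for each `(e_c, h, f_c)`, so `(ad c)³ y = 0` for `c ∈ dom f` (A1-114); polarise along lines
(`(ad a)² (ad c) y = 0`), extend linearly in `c` over `span(dom f) = 𝔞` (A1-111), and take the polar form in `a`.
This is the printed "`V` is invariant under the operators `e_a`" for the piece `V₋₂ → V₀`.
[cite: LooijengaLunts1997, §2 (2.1) p. 9 L98–L105] -/
theorem IsLefschetzTriple.lie_lie_lie_eq_zero_of_forall_dual (T : IsLefschetzTriple K h 𝔞) {y : L}
    (hy : y ∈ adDegree K h (-2)) (hyF : ∀ f ∈ lefschetzDuals K h 𝔞, ⁅f, y⁆ = 0) {a a' a'' : L} (ha : a ∈ 𝔞)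
    (ha' : a' ∈ 𝔞) (ha'' : a'' ∈ 𝔞) : ⁅a, ⁅a', ⁅a'', y⁆⁆⁆ = 0 := by
  -- Step A: `(ad c)³ y = 0` for `c ∈ dom f`
  have hA : ∀ c ∈ lefschetzDomain K h 𝔞, ((ad K L c) ^ 3) y = 0 := by
    rintro c ⟨hc, fc, tc⟩
    rw [ad_pow_succ_apply, ad_pow_succ_apply, pow_one, ad_apply]
    refine lie_e_lie_e_lie_e_eq_zero K tc (hyF fc ⟨c, hc, tc⟩) ?_
    rw [mem_adDegree_iff.1 hy, neg_smul, ofNat_smul_eq_nsmul]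
  -- Step B: `[a, [a, [c, y]]] = 0` for `a ∈ 𝔞`, `c ∈ dom f` (coefficient of `t²`)
  have hB : ∀ c ∈ lefschetzDomain K h 𝔞, ∀ b ∈ 𝔞, ⁅b, ⁅b, ⁅c, y⁆⁆⁆ = 0 := by
    intro c hc b hb
    have h1 := T.pow_ad_pow_ad_eq_zero hA hc hb (m := 2) (by norm_num)
    rwa [show 3 - 2 = 1 from rfl, pow_one, ad_apply, ad_pow_succ_apply, pow_one, ad_apply] at h1
  -- Step C: linear in `c`: extend to `c ∈ span(dom f) = 𝔞`
  have hC : ∀ x ∈ 𝔞, ∀ b ∈ 𝔞, ⁅b, ⁅b, ⁅x, y⁆⁆⁆ = 0 := by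
    intro x hx b hb
    rw [← T.span_lefschetzDomain] at hx
    induction hx using Submodule.span_induction with
    | mem c hc => exact hB c hc b hb
    | zero => rw [zero_lie, lie_zero, lie_zero]
    | add x x' _ _ hx hx' => rw [add_lie, lie_add, lie_add, hx, hx', add_zero]
    | smul r x _ hx => rw [smul_lie, lie_smul, lie_smul, hx, smul_zero]
  -- Step D: polar form in `b`
  exact lie_lie_eq_zero_of_forall_lie_lie_self T.lie_eq_zero (fun b hb ↦ hC a'' ha'' b hb) ha ha'

/-- **Under (ii) every partner spans a `V(2)` under every `e_a`, with all mixed cubics vanishing: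
`[a, [a', [a'', f_b]]] = 0`** for `a, a', a'' ∈ 𝔞`, `f_b ∈ f(dom f)` (the partners lie in `V₋₂ = C_{𝔤₋₂}(f(dom f))`
when they mutually commute). [cite: LooijengaLunts1997, §2 (2.1) p. 9 L98–L105 ("V(a) contains the image of 𝔞 … V is invariant under these operators")] -/
theorem IsLefschetzTriple.lie_lie_lie_dual_eq_zero (T : IsLefschetzTriple K h 𝔞)
    (hii : ∀ f ∈ lefschetzDuals K h 𝔞, ∀ f' ∈ lefschetzDuals K h 𝔞, ⁅f, f'⁆ = 0) {fb : L}
    (hfb : fb ∈ lefschetzDuals K h 𝔞) {a a' a'' : L} (ha : a ∈ 𝔞) (ha' : a' ∈ 𝔞) (ha'' : a'' ∈ 𝔞) :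
    ⁅a, ⁅a', ⁅a'', fb⁆⁆⁆ = 0 :=
  T.lie_lie_lie_eq_zero_of_forall_dual (lefschetzDuals_subset_adDegree hfb) (fun f hf ↦ hii f hf fb hfb) ha ha' ha''

/-- In particular **the degree-`2` elements `[a, [a', f_b]]` — among them A1-114's `[e_a, [e_a, f_b]]` — CENTRALISE
`𝔞`**: `[c, [a, [a', f_b]]] = 0` for `c, a, a' ∈ 𝔞` (under (ii)).  So they lie in `V₂ = C_{𝔤₂}(𝔞)`.
[cite: LooijengaLunts1997, §2 (2.1) p. 9 L98–L105] -/
theorem IsLefschetzTriple.lie_adTwo_dual_eq_zero (T : IsLefschetzTriple K h 𝔞)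
    (hii : ∀ f ∈ lefschetzDuals K h 𝔞, ∀ f' ∈ lefschetzDuals K h 𝔞, ⁅f, f'⁆ = 0) {fb : L}
    (hfb : fb ∈ lefschetzDuals K h 𝔞) {c a a' : L} (hc : c ∈ 𝔞) (ha : a ∈ 𝔞) (ha' : a' ∈ 𝔞) :
    ⁅c, ⁅a, ⁅a', fb⁆⁆⁆ = 0 :=
  T.lie_lie_lie_dual_eq_zero hii hfb hc ha ha'

/-- Dually, under (ii): **`[f_c, [f_a, [f_a, b]]] = 0`** for partners `f_a, f_c` and `b ∈ 𝔞` — the degree-`-2`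
elements `[f_a, [f_a, e_b]]` of A1-114 commute with `f(dom f)`, i.e. lie in `V₋₂`.  (`[f_c, (ad f_a)² b] =
(ad f_a)² [f_c, b]` as the `f`'s commute; `w = [b, f_c]` has weight `0` and `(ad a)² w = [b, (ad a)² f_c] = 0` by
`lie_adTwo_dual_eq_zero`, so `(ad f_a)² w = 0` by §2.) [cite: LooijengaLunts1997, §2 (2.1) p. 9 L98–L105] -/
theorem IsLefschetzTriple.dual_lie_adTwo_eq_zero (T : IsLefschetzTriple K h 𝔞)
    (hii : ∀ f ∈ lefschetzDuals K h 𝔞, ∀ f' ∈ lefschetzDuals K h 𝔞, ⁅f, f'⁆ = 0) {a fa fc b : L} (ha : a ∈ 𝔞)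
    (ta : IsSl2Triple h a fa) (hfc : fc ∈ lefschetzDuals K h 𝔞) (hb : b ∈ 𝔞) : ⁅fc, ⁅fa, ⁅fa, b⁆⁆⁆ = 0 := by
  have hfa : fa ∈ lefschetzDuals K h 𝔞 := ⟨a, ha, ta⟩
  have hcomm : ∀ m : L, ⁅fc, ⁅fa, m⁆⁆ = ⁅fa, ⁅fc, m⁆⁆ := fun m ↦ by
    have h1 := leibniz_lie fc fa m
    rw [hii fc hfc fa hfa, zero_lie, zero_add] at h1
    exact h1
  -- `w = [fc, b]` has weight `0` and `(ad a)² w = 0`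
  have hw : ⁅h, ⁅fc, b⁆⁆ = 0 := by
    have h1 := lie_mem_adDegree (lefschetzDuals_subset_adDegree hfc) (T.le_adDegree_two hb)
    rw [neg_add_cancel, mem_adDegree_iff, zero_smul] at h1
    exact h1
  have haaw : ⁅a, ⁅a, ⁅fc, b⁆⁆⁆ = 0 := by
    have h1 : ⁅fc, b⁆ = -⁅b, fc⁆ := (lie_skew _ _).symm
    rw [h1, lie_neg, lie_neg, neg_eq_zero]
    have h2 : ⁅a, ⁅a, ⁅b, fc⁆⁆⁆ = ⁅b, ⁅a, ⁅a, fc⁆⁆⁆ := by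
      have hab : ∀ m : L, ⁅a, ⁅b, m⁆⁆ = ⁅b, ⁅a, m⁆⁆ := fun m ↦ by
        have h3 := leibniz_lie a b m
        rw [T.lie_eq_zero a ha b hb, zero_lie, zero_add] at h3
        exact h3
      rw [hab, hab]
    rw [h2]
    exact T.lie_adTwo_dual_eq_zero hii hfc hb ha ha
  rw [hcomm, hcomm]
  exact lie_f_lie_f_eq_zero_of_lie_e_lie_e K ta hw haaw

end ESide

/-! ## §4 The reduction: (ii) ∧ (**) ⟹ `𝔤₄ = 0` -/

section Reduction

variable {K : Type*} [Field K] [CharZero K] {L : Type*} [LieRing L] [LieAlgebra K L] [FiniteDimensional K L]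
  {h : L} {𝔞 : Submodule K L}

/-- **`f`-side, piece `V₂ → V₀`, from the crux**: if `[[c, [c, f_b]], x] = 0` for all `c ∈ dom f`, partners `f_b`
and `x ∈ C_{𝔤₂}(𝔞)` then `[a, [a', [f_b, x]]] = 0` for all `a, a' ∈ 𝔞` (Jacobi, polarisation along lines, polar
form). [cite: LooijengaLunts1997, §2 (2.1) p. 9 L103–L105 ("V is invariant under these operators", the f_a on V₂)] -/
theorem IsLefschetzTriple.lie_lie_dual_lie_eq_zero_of_crux (T : IsLefschetzTriple K h 𝔞)
    (crux : ∀ a ∈ lefschetzDomain K h 𝔞, ∀ f ∈ lefschetzDuals K h 𝔞, ∀ x ∈ adDegree K h 2,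
      (∀ c ∈ 𝔞, ⁅c, x⁆ = 0) → ⁅⁅a, ⁅a, f⁆⁆, x⁆ = 0)
    {fb : L} (hfb : fb ∈ lefschetzDuals K h 𝔞) {x : L} (hx : x ∈ adDegree K h 2) (hxa : ∀ c ∈ 𝔞, ⁅c, x⁆ = 0)
    {a a' : L} (ha : a ∈ 𝔞) (ha' : a' ∈ 𝔞) : ⁅a, ⁅a', ⁅fb, x⁆⁆⁆ = 0 := by
  have h1 : ∀ c ∈ lefschetzDomain K h 𝔞, ((ad K L c) ^ 2) ⁅fb, x⁆ = 0 := by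
    intro c hc
    rw [ad_pow_succ_apply, pow_one, ad_apply, ← lie_adTwo_eq_of_lie_eq_zero (hxa c hc.1)]
    exact crux c hc fb hfb x hx hxa
  have h2 : ∀ b ∈ 𝔞, ⁅b, ⁅b, ⁅fb, x⁆⁆⁆ = 0 := by
    intro b hb
    obtain ⟨c, hc⟩ := T.nonempty_lefschetzDomain
    have h3 := T.pow_ad_pow_ad_eq_zero h1 hc hb (m := 2) le_rfl
    rwa [Nat.sub_self, pow_zero, Module.End.one_apply, ad_pow_succ_apply, pow_one, ad_apply] at h3
  exact lie_lie_eq_zero_of_forall_lie_lie_self T.lie_eq_zero h2 ha ha'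

/-- **`f`-side, piece `V₀ → V₋₂`, from (ii) and the crux**: for `w ∈ V₀` (weight `0`, `[𝔞, [𝔞, w]] = 0`) and
partners `f_b`, `f_c`: `[f_c, [f_b, w]] = 0`.  (`2[f_b, w] = [f_b, [f_b, [b, w]]]` by §2; the `f`'s commute, so
`2[f_c,[f_b,w]] = (ad f_b)² [f_c, [b, w]]`, and `w' = [f_c, [b, w]]` has `(ad b)² w' = [[b,[b,f_c]], [b,w]] = 0` by
the crux, hence `(ad f_b)² w' = 0` by §2.) [cite: LooijengaLunts1997, §2 (2.1) p. 9 L103–L105 (the f_a on V₀)] -/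
theorem IsLefschetzTriple.dual_lie_dual_lie_eq_zero_of_crux (T : IsLefschetzTriple K h 𝔞)
    (hii : ∀ f ∈ lefschetzDuals K h 𝔞, ∀ f' ∈ lefschetzDuals K h 𝔞, ⁅f, f'⁆ = 0)
    (crux : ∀ a ∈ lefschetzDomain K h 𝔞, ∀ f ∈ lefschetzDuals K h 𝔞, ∀ x ∈ adDegree K h 2,
      (∀ c ∈ 𝔞, ⁅c, x⁆ = 0) → ⁅⁅a, ⁅a, f⁆⁆, x⁆ = 0)
    {b fb : L} (hb : b ∈ 𝔞) (tb : IsSl2Triple h b fb) {w : L} (hw : w ∈ adDegree K h 0)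
    (hwV : ∀ a ∈ 𝔞, ∀ a' ∈ 𝔞, ⁅a, ⁅a', w⁆⁆ = 0) {fc : L} (hfc : fc ∈ lefschetzDuals K h 𝔞) :
    ⁅fc, ⁅fb, w⁆⁆ = 0 := by
  have hfb : fb ∈ lefschetzDuals K h 𝔞 := ⟨b, hb, tb⟩
  have hbU : b ∈ lefschetzDomain K h 𝔞 := ⟨hb, fb, tb⟩
  have hw0 : ⁅h, w⁆ = 0 := by rw [mem_adDegree_iff.1 hw, zero_smul]
  -- `z = [b, w] ∈ V₂`
  have hz2 : ⁅b, w⁆ ∈ adDegree K h 2 := by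
    have h1 := lie_mem_adDegree (T.le_adDegree_two hb) hw
    rwa [add_zero] at h1
  have hza : ∀ c ∈ 𝔞, ⁅c, ⁅b, w⁆⁆ = 0 := fun c hc ↦ hwV c hc b hb
  have hffw : ⁅fb, ⁅fb, w⁆⁆ = 0 := lie_f_lie_f_eq_zero_of_lie_e_lie_e K tb hw0 (hwV b hb b hb)
  have h2w := two_nsmul_lie_f_eq tb hw0 hffw
  -- `w' = [fc, z]`
  have hw' : ⁅h, ⁅fc, ⁅b, w⁆⁆⁆ = 0 := by
    have h1 := lie_mem_adDegree (lefschetzDuals_subset_adDegree hfc) hz2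
    rw [neg_add_cancel, mem_adDegree_iff, zero_smul] at h1
    exact h1
  have hbbw' : ⁅b, ⁅b, ⁅fc, ⁅b, w⁆⁆⁆⁆ = 0 := by
    rw [← lie_adTwo_eq_of_lie_eq_zero (hza b hb)]
    exact crux b hbU fc hfc _ hz2 hza
  have hffw' : ⁅fb, ⁅fb, ⁅fc, ⁅b, w⁆⁆⁆⁆ = 0 := lie_f_lie_f_eq_zero_of_lie_e_lie_e K tb hw' hbbw'
  have hcomm : ∀ m : L, ⁅fc, ⁅fb, m⁆⁆ = ⁅fb, ⁅fc, m⁆⁆ := fun m ↦ by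
    have h1 := leibniz_lie fc fb m
    rw [hii fc hfc fb hfb, zero_lie, zero_add] at h1
    exact h1
  have h3 : 2 • ⁅fc, ⁅fb, w⁆⁆ = 0 := by rw [← lie_nsmul, h2w, hcomm, hcomm, hffw']
  rw [← Nat.cast_smul_eq_nsmul K, smul_eq_zero] at h3
  exact h3.resolve_left (Nat.cast_ne_zero.2 two_ne_zero)

/-- **THE REDUCTION THEOREM.  For a Lefschetz triple `(𝔤, h, 𝔞)`: if (ii) the partners `f_a`, `a ∈ dom f`,
mutually commute, and (**) `[[a, [a, f_b]], x] = 0` for all `a ∈ dom f`, partners `f_b` and `x ∈ C_{𝔤₂}(𝔞)`, then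
`𝔤₄ = 0`** — the printed argument made honest: `V = V₋₂ + V₀ + V₂` (`V₂ = C_{𝔤₂}(𝔞)`,
`V₀ = {w ∈ 𝔤₀ : [𝔞, [𝔞, w]] = 0}`, `V₋₂ = C_{𝔤₋₂}(f(dom f))`) contains `𝔞` and `f(dom f)` and is stable under
`ad 𝔞` (§3) and — given (**) — under the `ad f_b` (the two lemmas above); the stabiliser of `V` is a Lie subalgebra
containing the generators, so `V` is an ideal, `V ⊇ 𝔤` as `𝔤` is generated by `𝔞 ∪ f(dom f)`, and `𝔤₄ ∩ V = 0`.
[cite: LooijengaLunts1997, §2 (2.1) p. 9 L94–L106] -/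
theorem IsLefschetzTriple.adDegree_four_eq_bot_of_crux (T : IsLefschetzTriple K h 𝔞)
    (hii : ∀ f ∈ lefschetzDuals K h 𝔞, ∀ f' ∈ lefschetzDuals K h 𝔞, ⁅f, f'⁆ = 0)
    (crux : ∀ a ∈ lefschetzDomain K h 𝔞, ∀ f ∈ lefschetzDuals K h 𝔞, ∀ x ∈ adDegree K h 2,
      (∀ c ∈ 𝔞, ⁅c, x⁆ = 0) → ⁅⁅a, ⁅a, f⁆⁆, x⁆ = 0) :
    adDegree K h 4 = ⊥ := by
  -- the three pieces of `V`
  set V₂ : Submodule K L := adDegree K h 2 ⊓ ⨅ c : 𝔞, LinearMap.ker (ad K L (c : L) : L →ₗ[K] L) with hV₂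
  set V₀ : Submodule K L :=
    adDegree K h 0 ⊓ ⨅ a : 𝔞, ⨅ a' : 𝔞, LinearMap.ker ((ad K L (a : L) : L →ₗ[K] L) ∘ₗ (ad K L (a' : L)))
    with hV₀
  set Vn : Submodule K L :=
    adDegree K h (-2) ⊓ ⨅ f : lefschetzDuals K h 𝔞, LinearMap.ker (ad K L (f : L) : L →ₗ[K] L) with hVn
  have m₂ : ∀ x : L, x ∈ V₂ ↔ x ∈ adDegree K h 2 ∧ ∀ c ∈ 𝔞, ⁅c, x⁆ = 0 := fun x ↦ by
    rw [hV₂, Submodule.mem_inf, Submodule.mem_iInf, Subtype.forall]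
    simp only [LinearMap.mem_ker, ad_apply]
  have m₀ : ∀ w : L, w ∈ V₀ ↔ w ∈ adDegree K h 0 ∧ ∀ a ∈ 𝔞, ∀ a' ∈ 𝔞, ⁅a, ⁅a', w⁆⁆ = 0 := fun w ↦ by
    rw [hV₀, Submodule.mem_inf, Submodule.mem_iInf, Subtype.forall]
    simp only [Submodule.mem_iInf, Subtype.forall, LinearMap.mem_ker, LinearMap.comp_apply, ad_apply]
  have mn : ∀ y : L, y ∈ Vn ↔ y ∈ adDegree K h (-2) ∧ ∀ f ∈ lefschetzDuals K h 𝔞, ⁅f, y⁆ = 0 := fun y ↦ by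
    rw [hVn, Submodule.mem_inf, Submodule.mem_iInf, Subtype.forall]
    simp only [LinearMap.mem_ker, ad_apply]
  set V : Submodule K L := Vn ⊔ V₀ ⊔ V₂ with hV
  have hdec : ∀ v ∈ V, ∃ y w x : L, y ∈ Vn ∧ w ∈ V₀ ∧ x ∈ V₂ ∧ v = y + w + x := by
    intro v hv
    obtain ⟨u, hu, x, hx, rfl⟩ := Submodule.mem_sup.1 hv
    obtain ⟨y, hy, w, hw, rfl⟩ := Submodule.mem_sup.1 hu
    exact ⟨y, w, x, hy, hw, hx, rfl⟩
  have hmk : ∀ {y w x : L}, y ∈ Vn → w ∈ V₀ → x ∈ V₂ → y + w + x ∈ V := fun hy hw hx ↦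
    add_mem (add_mem (Submodule.mem_sup_left (Submodule.mem_sup_left hy))
      (Submodule.mem_sup_left (Submodule.mem_sup_right hw))) (Submodule.mem_sup_right hx)
  -- `𝔞 ⊆ V₂`, `f(dom f) ⊆ V₋₂`
  have h𝔞V : ∀ a ∈ 𝔞, a ∈ V := fun a ha ↦ by
    have h1 : a ∈ V₂ := (m₂ a).2 ⟨T.le_adDegree_two ha, fun c hc ↦ T.lie_eq_zero c hc a ha⟩
    simpa only [zero_add] using hmk (zero_mem _) (zero_mem _) h1
  have hFV : ∀ f ∈ lefschetzDuals K h 𝔞, f ∈ V := fun f hf ↦ by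
    have h1 : f ∈ Vn := (mn f).2 ⟨lefschetzDuals_subset_adDegree hf, fun f' hf' ↦ hii f' hf' f hf⟩
    simpa only [add_zero] using hmk h1 (zero_mem _) (zero_mem _)
  -- stability under `ad a`, `a ∈ 𝔞` (§3)
  have hstab𝔞 : ∀ a ∈ 𝔞, ∀ v ∈ V, ⁅a, v⁆ ∈ V := by
    intro a ha v hv
    obtain ⟨y, w, x, hy, hw, hx, rfl⟩ := hdec v hv
    obtain ⟨hy₁, hy₂⟩ := (mn y).1 hy
    obtain ⟨hw₁, hw₂⟩ := (m₀ w).1 hw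
    obtain ⟨hx₁, hx₂⟩ := (m₂ x).1 hx
    have hay : ⁅a, y⁆ ∈ V₀ := by
      refine (m₀ _).2 ⟨?_, fun b hb b' hb' ↦ T.lie_lie_lie_eq_zero_of_forall_dual hy₁ hy₂ hb hb' ha⟩
      have h1 := lie_mem_adDegree (T.le_adDegree_two ha) hy₁
      rwa [add_neg_cancel] at h1
    have haw : ⁅a, w⁆ ∈ V₂ := by
      refine (m₂ _).2 ⟨?_, fun c hc ↦ hw₂ c hc a ha⟩
      have h1 := lie_mem_adDegree (T.le_adDegree_two ha) hw₁
      rwa [add_zero] at h1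
    rw [lie_add, lie_add, hx₂ a ha, add_zero]
    simpa only [zero_add] using hmk (zero_mem _) hay haw
  -- stability under `ad f_b` ((ii) and the crux)
  have hstabF : ∀ f ∈ lefschetzDuals K h 𝔞, ∀ v ∈ V, ⁅f, v⁆ ∈ V := by
    rintro f ⟨b, hb, tb⟩ v hv
    have hf : f ∈ lefschetzDuals K h 𝔞 := ⟨b, hb, tb⟩
    obtain ⟨y, w, x, hy, hw, hx, rfl⟩ := hdec v hv
    obtain ⟨hy₁, hy₂⟩ := (mn y).1 hy
    obtain ⟨hw₁, hw₂⟩ := (m₀ w).1 hw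
    obtain ⟨hx₁, hx₂⟩ := (m₂ x).1 hx
    have hfw : ⁅f, w⁆ ∈ Vn := by
      refine (mn _).2 ⟨?_, fun fc hfc ↦ T.dual_lie_dual_lie_eq_zero_of_crux hii crux hb tb hw₁ hw₂ hfc⟩
      have h1 := lie_mem_adDegree (lefschetzDuals_subset_adDegree hf) hw₁
      rwa [add_zero] at h1
    have hfx : ⁅f, x⁆ ∈ V₀ := by
      refine (m₀ _).2 ⟨?_, fun a ha a' ha' ↦ T.lie_lie_dual_lie_eq_zero_of_crux crux hf hx₁ hx₂ ha ha'⟩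
      have h1 := lie_mem_adDegree (lefschetzDuals_subset_adDegree hf) hx₁
      rwa [show (-2 : K) + 2 = 0 by norm_num] at h1
    rw [lie_add, lie_add, hy₂ f hf, zero_add]
    simpa only [add_zero] using hmk hfw hfx (zero_mem _)
  -- the stabiliser of `V` is a Lie subalgebra containing the generators, hence everything
  let N : LieSubalgebra K L :=
    { carrier := {y | ∀ v ∈ V, ⁅y, v⁆ ∈ V}
      add_mem' := fun {y y'} hy hy' v hv ↦ by rw [add_lie]; exact add_mem (hy v hv) (hy' v hv)
      zero_mem' := fun v _ ↦ by rw [zero_lie]; exact zero_mem _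
      smul_mem' := fun r {y} hy v hv ↦ by rw [smul_lie]; exact Submodule.smul_mem _ r (hy v hv)
      lie_mem' := fun {y y'} hy hy' v hv ↦ by rw [lie_lie]; exact sub_mem (hy _ (hy' v hv)) (hy' _ (hy v hv)) }
  have hN : ∀ y : L, ∀ v ∈ V, ⁅y, v⁆ ∈ V := by
    intro y
    have hgen : LieSubalgebra.lieSpan K L ((𝔞 : Set L) ∪ lefschetzDuals K h 𝔞) ≤ N := by
      rw [LieSubalgebra.lieSpan_le]
      rintro z (hz | hz)
      · exact hstab𝔞 z hz
      · exact hstabF z hz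
    have hy : y ∈ LieSubalgebra.lieSpan K L ((𝔞 : Set L) ∪ lefschetzDuals K h 𝔞) := by
      rw [T.lieSpan_eq_top]; exact trivial
    exact hgen hy
  -- so `V` is a Lie subalgebra containing the generators: `V = 𝔤`
  let W : LieSubalgebra K L := { V with lie_mem' := fun {y v} _ hv ↦ hN y v hv }
  have hVtop : ∀ y : L, y ∈ V := by
    intro y
    have hgen : LieSubalgebra.lieSpan K L ((𝔞 : Set L) ∪ lefschetzDuals K h 𝔞) ≤ W := by
      rw [LieSubalgebra.lieSpan_le]
      rintro z (hz | hz)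
      · exact h𝔞V z hz
      · exact hFV z hz
    have hy : y ∈ LieSubalgebra.lieSpan K L ((𝔞 : Set L) ∪ lefschetzDuals K h 𝔞) := by
      rw [T.lieSpan_eq_top]; exact trivial
    exact hgen hy
  -- `V ⊆ 𝔤₋₂ + 𝔤₀ + 𝔤₂`, so `𝔤₄ = 0`
  have hle : V ≤ ⨆ i : Fin 3, adDegree K h ((![-2, 0, 2] : Fin 3 → K) i) := by
    rw [hV]
    refine sup_le (sup_le ?_ ?_) ?_
    · exact le_iSup_of_le 0 fun y hy ↦ ((mn y).1 hy).1
    · exact le_iSup_of_le 1 fun w hw ↦ ((m₀ w).1 hw).1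
    · exact le_iSup_of_le 2 fun x hx ↦ ((m₂ x).1 hx).1
  have htop : ⨆ i : Fin 3, adDegree K h ((![-2, 0, 2] : Fin 3 → K) i) = ⊤ :=
    eq_top_iff.2 fun y _ ↦ hle (hVtop y)
  refine adDegree_eq_bot_of_iSup_eq_top h htop fun i ↦ ?_
  fin_cases i <;> norm_num

/-- Hence **(ii) ∧ (**) make `(𝔤, h)` a Jordan–Lefschetz pair** (A1-104: a Lefschetz triple with `𝔤₄ = 0` is
Jordan–Lefschetz). [cite: LooijengaLunts1997, §2 (2.1) p. 9 L79–L106, (2.2) p. 9 L108–L110] -/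
theorem IsLefschetzTriple.isJordanLefschetzPair_of_crux (T : IsLefschetzTriple K h 𝔞)
    (hii : ∀ f ∈ lefschetzDuals K h 𝔞, ∀ f' ∈ lefschetzDuals K h 𝔞, ⁅f, f'⁆ = 0)
    (crux : ∀ a ∈ lefschetzDomain K h 𝔞, ∀ f ∈ lefschetzDuals K h 𝔞, ∀ x ∈ adDegree K h 2,
      (∀ c ∈ 𝔞, ⁅c, x⁆ = 0) → ⁅⁅a, ⁅a, f⁆⁆, x⁆ = 0) :
    IsJordanLefschetzPair K h :=
  T.isJordanLefschetzPair_of_adDegree_four_eq_bot (T.adDegree_four_eq_bot_of_crux hii crux)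

/-- **(2.1) with the crux made explicit: (i) ⟺ (ii) ∧ (**).**  The forward direction is the trivial one: in a
Jordan–Lefschetz pair `𝔤₋₂` is abelian (A1-84 `IsJordanLefschetzPair.lie_eq_zero_of_mem_lefschetzDuals`) and
`[[a,[a,f_b]], x] ∈ 𝔤₄ = 0`. [cite: LooijengaLunts1997, §2 (2.1) p. 9 L79–L106] -/
theorem IsLefschetzTriple.isJordanLefschetzPair_iff_dual_comm_and_crux (T : IsLefschetzTriple K h 𝔞) :
    IsJordanLefschetzPair K h ↔
      (∀ f ∈ lefschetzDuals K h 𝔞, ∀ f' ∈ lefschetzDuals K h 𝔞, ⁅f, f'⁆ = 0) ∧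
        ∀ a ∈ lefschetzDomain K h 𝔞, ∀ f ∈ lefschetzDuals K h 𝔞, ∀ x ∈ adDegree K h 2,
          (∀ c ∈ 𝔞, ⁅c, x⁆ = 0) → ⁅⁅a, ⁅a, f⁆⁆, x⁆ = 0 := by
  constructor
  · intro J
    have h4 : adDegree K h 4 = ⊥ := T.isJordanLefschetzPair_iff.1 J
    refine ⟨fun f hf f' hf' ↦ J.lie_eq_zero_of_mem_lefschetzDuals (lefschetzDuals_mono T.le_adDegree_two hf)
      (lefschetzDuals_mono T.le_adDegree_two hf'), fun a ha f hf x hx _ ↦ ?_⟩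
    have h1 := lie_mem_adDegree (T.le_adDegree_two ha.1) (lefschetzDuals_subset_adDegree hf)
    have h2 := lie_mem_adDegree (T.le_adDegree_two ha.1) h1
    have h3 := lie_mem_adDegree h2 hx
    rw [show (2 : K) + (2 + -2) + 2 = 4 by norm_num, h4, Submodule.mem_bot] at h3
    exact h3
  · rintro ⟨hii, crux⟩
    exact T.isJordanLefschetzPair_of_crux hii crux

end Reduction

/-! ## §5 The subspace criterion; (2.1) for saturated triples -/

section Subspace

variable {K : Type*} [Field K] [CharZero K] {L : Type*} [LieRing L] [LieAlgebra K L] [FiniteDimensional K L]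
  {h : L} {𝔞 : Submodule K L}

/-- **A degree-`-2` vector of type `≤ 2` under `e_b` is a lowest weight vector**: for `b ∈ 𝔞` with partner `f_b`
and `y ∈ 𝔤₋₂`, `(ad b)³ y = 0` implies `[f_b, y] = 0`.  (Leibniz gives `(ad b)³ [f_b, y] =
-2 (ad b)² y + 2 (ad b)² y + [f_b, (ad b)³ y] = 0`, and `(ad b)⁴ : 𝔤₋₄ ≅ 𝔤₄` is injective — condition (i) of the
triple, A1-88.) [cite: LooijengaLunts1997, §2 (2.1) p. 9 L100–L102 ("annihilated by … ad³(e_a), or alternatively, by … ad(f_a)", k = -1)] -/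
theorem IsLefschetzTriple.dual_lie_eq_zero_of_ad_cube_eq_zero (T : IsLefschetzTriple K h 𝔞) {b fb : L}
    (hb : b ∈ 𝔞) (tb : IsSl2Triple h b fb) {y : L} (hy : y ∈ adDegree K h (-2))
    (h3 : ⁅b, ⁅b, ⁅b, y⁆⁆⁆ = 0) : ⁅fb, y⁆ = 0 := by
  have Lb : HasLefschetzProperty (ad K L h) (ad K L b) := T.hasLefschetzProperty_ad ⟨hb, fb, tb⟩
  have hstep : ∀ m : L, ⁅b, ⁅fb, m⁆⁆ = ⁅h, m⁆ + ⁅fb, ⁅b, m⁆⁆ := fun m ↦ by rw [leibniz_lie b fb m, tb.lie_e_f]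
  have hy' : ⁅h, y⁆ = (-2 : K) • y := mem_adDegree_iff.1 hy
  have hby : ⁅h, ⁅b, y⁆⁆ = 0 := by
    have h1 := lie_mem_adDegree (T.le_adDegree_two hb) hy
    rw [add_neg_cancel, mem_adDegree_iff, zero_smul] at h1
    exact h1
  have hbby : ⁅h, ⁅b, ⁅b, y⁆⁆⁆ = (2 : K) • ⁅b, ⁅b, y⁆⁆ := by
    have h1 := lie_mem_adDegree (T.le_adDegree_two hb) (lie_mem_adDegree (T.le_adDegree_two hb) hy)
    rw [show (2 : K) + (2 + -2) = 2 by norm_num, mem_adDegree_iff] at h1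
    exact h1
  have h4 : ⁅b, ⁅b, ⁅b, ⁅fb, y⁆⁆⁆⁆ = 0 := by
    rw [hstep, lie_add, hstep, lie_add, lie_add, hstep, h3, lie_zero, add_zero, hby, lie_zero, zero_add, hbby,
      hy', lie_smul, lie_smul, neg_smul, neg_add_cancel]
  have hz : ⁅fb, y⁆ ∈ degreeSpace (ad K L h) (-(4 : ℤ)) := by
    rw [← adDegree_intCast_eq_degreeSpace]
    have h1 := lie_mem_adDegree (lefschetzDuals_subset_adDegree ⟨b, hb, tb⟩) hy
    rw [show (-2 : K) + -2 = ((-(4 : ℤ) : ℤ) : K) by push_cast; norm_num] at h1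
    exact h1
  refine Lb.eq_zero_of_pow_apply_eq_zero (n := 4) (by norm_num) hz ?_
  rw [show (4 : ℤ).toNat = 3 + 1 from rfl, ad_pow_succ_apply, ad_pow_succ_apply, ad_pow_succ_apply, pow_one, ad_apply,
    h4, lie_zero]

/-- **THE SUBSPACE CRITERION.  Let `(𝔤, h, 𝔞)` be a Lefschetz triple and `𝔟` an abelian subspace of `𝔤₂` containing
`𝔞` such that, for every partner `f_b ∈ f(dom f)` and every `x ∈ 𝔟`, `(ad x)³ f_b = 0` and `(ad x)² f_b ∈ 𝔟`.  Then
`𝔤₄ = 0`.**  (Looijenga–Lunts' `V` built on `𝔟` instead of `𝔞`: `V₂ = C_{𝔤₂}(𝔟)`, `V₀ = {w : (ad x)² w = 0 ∀ x ∈ 𝔟}`,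
`V₋₂ = {y : (ad x)³ y = 0 ∀ x ∈ 𝔟}`; `ad 𝔟`-stability is polarisation over the SPACE `𝔟` (no Zariski-openness
needed), `ad f_b`-stability is Leibniz: `(ad x)²[f_b, z] = [(ad x)² f_b, z] = 0` for `z ∈ C(𝔟)` as
`(ad x)² f_b ∈ 𝔟`, `(ad x)³[f_b, w] = 3[(ad x)² f_b, [x, w]] = 0`, and `[f_b, V₋₂] = 0` by the previous lemma; so
`V` is an ideal containing the generators.)  In the Jordan/loop models `𝔟 = 𝔤₂` (the Jordan algebra, with
`(ad x)² f_b = -2 P(x) b⁻¹`). [cite: LooijengaLunts1997, §2 (2.1) p. 9 L94–L106] -/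
theorem IsLefschetzTriple.adDegree_four_eq_bot_of_subspace (T : IsLefschetzTriple K h 𝔞) {𝔟 : Submodule K L}
    (h𝔟₂ : 𝔟 ≤ adDegree K h 2) (h𝔞𝔟 : 𝔞 ≤ 𝔟) (h𝔟 : ∀ x ∈ 𝔟, ∀ y ∈ 𝔟, ⁅x, y⁆ = 0)
    (h3 : ∀ x ∈ 𝔟, ∀ f ∈ lefschetzDuals K h 𝔞, ⁅x, ⁅x, ⁅x, f⁆⁆⁆ = 0)
    (h4 : ∀ x ∈ 𝔟, ∀ f ∈ lefschetzDuals K h 𝔞, ⁅x, ⁅x, f⁆⁆ ∈ 𝔟) : adDegree K h 4 = ⊥ := by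
  -- polar forms of the hypotheses
  have hcomm : ∀ x ∈ 𝔟, ∀ x' ∈ 𝔟, ∀ m : L, ⁅x, ⁅x', m⁆⁆ = ⁅x', ⁅x, m⁆⁆ := fun x hx x' hx' m ↦ by
    have h1 := leibniz_lie x x' m
    rw [h𝔟 x hx x' hx', zero_lie, zero_add] at h1
    exact h1
  have h4' : ∀ x ∈ 𝔟, ∀ x' ∈ 𝔟, ∀ f ∈ lefschetzDuals K h 𝔞, ⁅x, ⁅x', f⁆⁆ ∈ 𝔟 := by
    intro x hx x' hx' f hf
    have h1 : ⁅x + x', ⁅x + x', f⁆⁆ - ⁅x, ⁅x, f⁆⁆ - ⁅x', ⁅x', f⁆⁆ = (2 : K) • ⁅x, ⁅x', f⁆⁆ := by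
      rw [add_lie, add_lie, lie_add, lie_add, hcomm x' hx' x hx, ofNat_smul_eq_nsmul, two_nsmul]
      abel
    have h2 : (2 : K)⁻¹ • ((2 : K) • ⁅x, ⁅x', f⁆⁆) ∈ 𝔟 := by
      rw [← h1]
      exact Submodule.smul_mem _ _ (sub_mem (sub_mem (h4 _ (add_mem hx hx') f hf) (h4 x hx f hf)) (h4 x' hx' f hf))
    rwa [smul_smul, inv_mul_cancel₀ (two_ne_zero' K), one_smul] at h2
  -- the three pieces of `V`
  set V₂ : Submodule K L := adDegree K h 2 ⊓ ⨅ x : 𝔟, LinearMap.ker (ad K L (x : L) : L →ₗ[K] L) with hV₂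
  set V₀ : Submodule K L :=
    adDegree K h 0 ⊓ ⨅ x : 𝔟, LinearMap.ker ((ad K L (x : L) : L →ₗ[K] L) ∘ₗ (ad K L (x : L))) with hV₀
  set Vn : Submodule K L :=
    adDegree K h (-2) ⊓ ⨅ x : 𝔟, LinearMap.ker ((ad K L (x : L) : L →ₗ[K] L) ∘ₗ (ad K L (x : L)) ∘ₗ (ad K L (x : L)))
    with hVn
  have m₂ : ∀ z : L, z ∈ V₂ ↔ z ∈ adDegree K h 2 ∧ ∀ x ∈ 𝔟, ⁅x, z⁆ = 0 := fun z ↦ by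
    rw [hV₂, Submodule.mem_inf, Submodule.mem_iInf, Subtype.forall]
    simp only [LinearMap.mem_ker, ad_apply]
  have m₀ : ∀ w : L, w ∈ V₀ ↔ w ∈ adDegree K h 0 ∧ ∀ x ∈ 𝔟, ⁅x, ⁅x, w⁆⁆ = 0 := fun w ↦ by
    rw [hV₀, Submodule.mem_inf, Submodule.mem_iInf, Subtype.forall]
    simp only [LinearMap.mem_ker, LinearMap.comp_apply, ad_apply]
  have mn : ∀ y : L, y ∈ Vn ↔ y ∈ adDegree K h (-2) ∧ ∀ x ∈ 𝔟, ⁅x, ⁅x, ⁅x, y⁆⁆⁆ = 0 := fun y ↦ by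
    rw [hVn, Submodule.mem_inf, Submodule.mem_iInf, Subtype.forall]
    simp only [LinearMap.mem_ker, LinearMap.comp_apply, ad_apply]
  -- polar consequences of membership
  have m₀' : ∀ w ∈ V₀, ∀ x ∈ 𝔟, ∀ x' ∈ 𝔟, ⁅x, ⁅x', w⁆⁆ = 0 := fun w hw x hx x' hx' ↦
    lie_lie_eq_zero_of_forall_lie_lie_self h𝔟 ((m₀ w).1 hw).2 hx hx'
  have mn' : ∀ y ∈ Vn, ∀ x ∈ 𝔟, ∀ x' ∈ 𝔟, ⁅x', ⁅x', ⁅x, y⁆⁆⁆ = 0 := by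
    intro y hy x hx x' hx'
    have hv : ∀ x ∈ 𝔟, ((ad K L x) ^ 3) y = 0 := fun x hx ↦ by
      rw [ad_pow_succ_apply, ad_pow_succ_apply, pow_one, ad_apply]; exact ((mn y).1 hy).2 x hx
    have h1 := pow_ad_pow_ad_eq_zero_of_forall_mem h𝔟 hv hx hx' (m := 2) (by norm_num)
    rwa [show 3 - 2 = 1 from rfl, pow_one, ad_apply, ad_pow_succ_apply, pow_one, ad_apply] at h1
  set V : Submodule K L := Vn ⊔ V₀ ⊔ V₂ with hV
  have hdec : ∀ v ∈ V, ∃ y w z : L, y ∈ Vn ∧ w ∈ V₀ ∧ z ∈ V₂ ∧ v = y + w + z := by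
    intro v hv
    obtain ⟨u, hu, z, hz, rfl⟩ := Submodule.mem_sup.1 hv
    obtain ⟨y, hy, w, hw, rfl⟩ := Submodule.mem_sup.1 hu
    exact ⟨y, w, z, hy, hw, hz, rfl⟩
  have hmk : ∀ {y w z : L}, y ∈ Vn → w ∈ V₀ → z ∈ V₂ → y + w + z ∈ V := fun hy hw hz ↦
    add_mem (add_mem (Submodule.mem_sup_left (Submodule.mem_sup_left hy))
      (Submodule.mem_sup_left (Submodule.mem_sup_right hw))) (Submodule.mem_sup_right hz)
  -- generators inside `V`
  have h𝔞V : ∀ a ∈ 𝔞, a ∈ V := fun a ha ↦ by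
    have h1 : a ∈ V₂ := (m₂ a).2 ⟨T.le_adDegree_two ha, fun x hx ↦ h𝔟 x hx a (h𝔞𝔟 ha)⟩
    simpa only [zero_add] using hmk (zero_mem _) (zero_mem _) h1
  have hFV : ∀ f ∈ lefschetzDuals K h 𝔞, f ∈ V := fun f hf ↦ by
    have h1 : f ∈ Vn := (mn f).2 ⟨lefschetzDuals_subset_adDegree hf, fun x hx ↦ h3 x hx f hf⟩
    simpa only [add_zero] using hmk h1 (zero_mem _) (zero_mem _)
  -- stability under `ad x`, `x ∈ 𝔟`
  have hstab𝔟 : ∀ x ∈ 𝔟, ∀ v ∈ V, ⁅x, v⁆ ∈ V := by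
    intro x hx v hv
    obtain ⟨y, w, z, hy, hw, hz, rfl⟩ := hdec v hv
    obtain ⟨hy₁, hy₂⟩ := (mn y).1 hy
    obtain ⟨hw₁, hw₂⟩ := (m₀ w).1 hw
    obtain ⟨hz₁, hz₂⟩ := (m₂ z).1 hz
    have hxy : ⁅x, y⁆ ∈ V₀ := by
      refine (m₀ _).2 ⟨?_, fun x' hx' ↦ mn' y hy x hx x' hx'⟩
      have h1 := lie_mem_adDegree (h𝔟₂ hx) hy₁
      rwa [add_neg_cancel] at h1
    have hxw : ⁅x, w⁆ ∈ V₂ := by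
      refine (m₂ _).2 ⟨?_, fun x' hx' ↦ m₀' w hw x' hx' x hx⟩
      have h1 := lie_mem_adDegree (h𝔟₂ hx) hw₁
      rwa [add_zero] at h1
    rw [lie_add, lie_add, hz₂ x hx, add_zero]
    simpa only [zero_add] using hmk (zero_mem _) hxy hxw
  -- stability under `ad f_b`
  have hstabF : ∀ f ∈ lefschetzDuals K h 𝔞, ∀ v ∈ V, ⁅f, v⁆ ∈ V := by
    rintro f ⟨b, hb, tb⟩ v hv
    have hf : f ∈ lefschetzDuals K h 𝔞 := ⟨b, hb, tb⟩
    obtain ⟨y, w, z, hy, hw, hz, rfl⟩ := hdec v hv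
    obtain ⟨hy₁, hy₂⟩ := (mn y).1 hy
    obtain ⟨hw₁, hw₂⟩ := (m₀ w).1 hw
    obtain ⟨hz₁, hz₂⟩ := (m₂ z).1 hz
    -- `[f, y] = 0`
    have hfy : ⁅f, y⁆ = 0 := T.dual_lie_eq_zero_of_ad_cube_eq_zero hb tb hy₁ (hy₂ b (h𝔞𝔟 hb))
    -- `[f, w] ∈ V₋₂`
    have hfw : ⁅f, w⁆ ∈ Vn := by
      refine (mn _).2 ⟨?_, fun x hx ↦ ?_⟩
      · have h1 := lie_mem_adDegree (lefschetzDuals_subset_adDegree hf) hw₁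
        rwa [add_zero] at h1
      · have e1 : ⁅⁅x, ⁅x, ⁅x, f⁆⁆⁆, w⁆ = 0 := by rw [h3 x hx f hf, zero_lie]
        have e2 : ⁅⁅x, ⁅x, f⁆⁆, ⁅x, w⁆⁆ = 0 := m₀' w hw _ (h4 x hx f hf) x hx
        rw [ad_cube_lie, e1, e2, hw₂ x hx]
        simp only [lie_zero, nsmul_zero, add_zero]
    -- `[f, z] ∈ V₀`
    have hfz : ⁅f, z⁆ ∈ V₀ := by
      refine (m₀ _).2 ⟨?_, fun x hx ↦ ?_⟩
      · have h1 := lie_mem_adDegree (lefschetzDuals_subset_adDegree hf) hz₁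
        rwa [show (-2 : K) + 2 = 0 by norm_num] at h1
      · rw [ad_sq_lie, hz₂ x hx, hz₂ _ (h4 x hx f hf)]
        simp only [lie_zero, nsmul_zero, add_zero]
    rw [lie_add, lie_add, hfy, zero_add]
    simpa only [add_zero] using hmk hfw hfz (zero_mem _)
  -- the stabiliser of `V` is a Lie subalgebra containing the generators, hence everything
  let N : LieSubalgebra K L :=
    { carrier := {u | ∀ v ∈ V, ⁅u, v⁆ ∈ V}
      add_mem' := fun {u u'} hu hu' v hv ↦ by rw [add_lie]; exact add_mem (hu v hv) (hu' v hv)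
      zero_mem' := fun v _ ↦ by rw [zero_lie]; exact zero_mem _
      smul_mem' := fun r {u} hu v hv ↦ by rw [smul_lie]; exact Submodule.smul_mem _ r (hu v hv)
      lie_mem' := fun {u u'} hu hu' v hv ↦ by rw [lie_lie]; exact sub_mem (hu _ (hu' v hv)) (hu' _ (hu v hv)) }
  have hN : ∀ u : L, ∀ v ∈ V, ⁅u, v⁆ ∈ V := by
    intro u
    have hgen : LieSubalgebra.lieSpan K L ((𝔞 : Set L) ∪ lefschetzDuals K h 𝔞) ≤ N := by
      rw [LieSubalgebra.lieSpan_le]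
      rintro x (hx | hx)
      · exact hstab𝔟 x (h𝔞𝔟 hx)
      · exact hstabF x hx
    have hu : u ∈ LieSubalgebra.lieSpan K L ((𝔞 : Set L) ∪ lefschetzDuals K h 𝔞) := by
      rw [T.lieSpan_eq_top]; exact trivial
    exact hgen hu
  let W : LieSubalgebra K L := { V with lie_mem' := fun {u v} _ hv ↦ hN u v hv }
  have hVtop : ∀ u : L, u ∈ V := by
    intro u
    have hgen : LieSubalgebra.lieSpan K L ((𝔞 : Set L) ∪ lefschetzDuals K h 𝔞) ≤ W := by
      rw [LieSubalgebra.lieSpan_le]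
      rintro x (hx | hx)
      · exact h𝔞V x hx
      · exact hFV x hx
    have hu : u ∈ LieSubalgebra.lieSpan K L ((𝔞 : Set L) ∪ lefschetzDuals K h 𝔞) := by
      rw [T.lieSpan_eq_top]; exact trivial
    exact hgen hu
  have hle : V ≤ ⨆ i : Fin 3, adDegree K h ((![-2, 0, 2] : Fin 3 → K) i) := by
    rw [hV]
    refine sup_le (sup_le ?_ ?_) ?_
    · exact le_iSup_of_le 0 fun y hy ↦ ((mn y).1 hy).1
    · exact le_iSup_of_le 1 fun w hw ↦ ((m₀ w).1 hw).1
    · exact le_iSup_of_le 2 fun z hz ↦ ((m₂ z).1 hz).1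
  have htop : ⨆ i : Fin 3, adDegree K h ((![-2, 0, 2] : Fin 3 → K) i) = ⊤ :=
    eq_top_iff.2 fun u _ ↦ hle (hVtop u)
  refine adDegree_eq_bot_of_iSup_eq_top h htop fun i ↦ ?_
  fin_cases i <;> norm_num

/-- Conversely, **if `𝔤₄ = 0` then `𝔟 = 𝔤₂` satisfies the subspace criterion**; so (2.1) (i) holds iff `𝔞`
extends to an abelian `𝔟 ⊆ 𝔤₂` with `(ad 𝔟)³ f(dom f) = 0` and `(ad x)² f_b ∈ 𝔟` (`x ∈ 𝔟`) — in the Jordan models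
`𝔟` is the Jordan algebra `𝔤₂` itself. [cite: LooijengaLunts1997, §2 (2.1)–(2.2) p. 9 L79–L114] -/
theorem IsLefschetzTriple.isJordanLefschetzPair_iff_exists_subspace (T : IsLefschetzTriple K h 𝔞) :
    IsJordanLefschetzPair K h ↔ ∃ 𝔟 : Submodule K L, 𝔟 ≤ adDegree K h 2 ∧ 𝔞 ≤ 𝔟 ∧
      (∀ x ∈ 𝔟, ∀ y ∈ 𝔟, ⁅x, y⁆ = 0) ∧ (∀ x ∈ 𝔟, ∀ f ∈ lefschetzDuals K h 𝔞, ⁅x, ⁅x, ⁅x, f⁆⁆⁆ = 0) ∧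
        ∀ x ∈ 𝔟, ∀ f ∈ lefschetzDuals K h 𝔞, ⁅x, ⁅x, f⁆⁆ ∈ 𝔟 := by
  constructor
  · intro J
    have h4 : adDegree K h 4 = ⊥ := T.isJordanLefschetzPair_iff.1 J
    refine ⟨adDegree K h 2, le_rfl, T.le_adDegree_two, fun x hx y hy ↦ J.lie_eq_zero_of_mem_adDegree_two hx hy,
      fun x hx f hf ↦ ?_, fun x hx f hf ↦ ?_⟩
    · have h1 := lie_mem_adDegree hx (lie_mem_adDegree hx (lie_mem_adDegree hx (lefschetzDuals_subset_adDegree hf)))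
      rw [show (2 : K) + (2 + (2 + -2)) = 4 by norm_num, h4, Submodule.mem_bot] at h1
      exact h1
    · have h1 := lie_mem_adDegree hx (lie_mem_adDegree hx (lefschetzDuals_subset_adDegree hf))
      rwa [show (2 : K) + (2 + -2) = 2 by norm_num] at h1
  · rintro ⟨𝔟, h𝔟₂, h𝔞𝔟, h𝔟, h3, h4⟩
    exact T.isJordanLefschetzPair_of_adDegree_four_eq_bot (T.adDegree_four_eq_bot_of_subspace h𝔟₂ h𝔞𝔟 h𝔟 h3 h4)

/-- **The case `𝔟 = 𝔞`: under (ii), if `𝔞` is closed under the quadratic maps `x ↦ (ad x)² f_b` (`f_b ∈ f(dom f)`),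
then `𝔤₄ = 0`** — (ii) is exactly `(ad 𝔞)³ f(dom f) = 0` (§3). [cite: LooijengaLunts1997, §2 (2.1) p. 9 L79–L106] -/
theorem IsLefschetzTriple.adDegree_four_eq_bot_of_lie_lie_dual_mem (T : IsLefschetzTriple K h 𝔞)
    (hii : ∀ f ∈ lefschetzDuals K h 𝔞, ∀ f' ∈ lefschetzDuals K h 𝔞, ⁅f, f'⁆ = 0)
    (hcl : ∀ x ∈ 𝔞, ∀ f ∈ lefschetzDuals K h 𝔞, ⁅x, ⁅x, f⁆⁆ ∈ 𝔞) : adDegree K h 4 = ⊥ :=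
  T.adDegree_four_eq_bot_of_subspace T.le_adDegree_two le_rfl T.lie_eq_zero
    (fun _ hx _ hf ↦ T.lie_lie_lie_dual_eq_zero hii hf hx hx hx) hcl

omit [CharZero K] [FiniteDimensional K L] in
/-- **Enlarging `𝔞`**: if `p ∈ 𝔤₂` commutes with `𝔞` then `(𝔤, h, 𝔞 + K p)` is again a Lefschetz triple (abelian;
`dom f` and the generators only grow). [cite: LooijengaLunts1997, §1 p. 7 L78–L82 ("saturated if 𝔞 is maximal for this property")] -/
theorem IsLefschetzTriple.sup_span_singleton (T : IsLefschetzTriple K h 𝔞) {p : L} (hp : p ∈ adDegree K h 2)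
    (hp𝔞 : ∀ a ∈ 𝔞, ⁅a, p⁆ = 0) : IsLefschetzTriple K h (𝔞 ⊔ K ∙ p) := by
  have hle : 𝔞 ≤ 𝔞 ⊔ K ∙ p := le_sup_left
  have hmem : ∀ x ∈ 𝔞 ⊔ K ∙ p, ∃ a ∈ 𝔞, ∃ r : K, x = a + r • p := fun x hx ↦ by
    obtain ⟨a, ha, q, hq, rfl⟩ := Submodule.mem_sup.1 hx
    obtain ⟨r, rfl⟩ := Submodule.mem_span_singleton.1 hq
    exact ⟨a, ha, r, rfl⟩
  exact
    { isSemisimple := T.isSemisimple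
      le_adDegree_two := sup_le T.le_adDegree_two ((Submodule.span_singleton_le_iff_mem p _).2 hp)
      lie_eq_zero := fun x hx y hy ↦ by
        obtain ⟨a, ha, r, rfl⟩ := hmem x hx
        obtain ⟨a', ha', r', rfl⟩ := hmem y hy
        rw [add_lie, lie_add, lie_add, T.lie_eq_zero a ha a' ha', lie_smul, hp𝔞 a ha, smul_lie, smul_lie,
          ← lie_skew p a', hp𝔞 a' ha', lie_smul, lie_self]
        simp only [smul_zero, neg_zero, add_zero]
      nonempty_lefschetzDomain := by
        obtain ⟨e, he⟩ := T.nonempty_lefschetzDomain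
        exact ⟨e, lefschetzDomain_mono hle he⟩
      lieSpan_eq_top := by
        rw [eq_top_iff, ← T.lieSpan_eq_top]
        exact LieSubalgebra.lieSpan_mono (Set.union_subset_union (fun a ha ↦ hle ha) (lefschetzDuals_mono hle)) }

/-- **LOOIJENGA–LUNTS (2.1) (ii) ⟹ (i) FOR SATURATED TRIPLES.  A saturated Lefschetz triple `(𝔤, h, 𝔞)` (A1-84:
`𝔞` maximal) whose partners `f_a`, `a ∈ dom f`, mutually commute is Jordan–Lefschetz: `𝔤` has degrees `-2, 0, 2`
only.**  Proof: for `x ∈ 𝔞` and a partner `f_b`, `p = (ad x)² f_b ∈ 𝔤₂` commutes with `𝔞` (§3, under (ii)), so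
`(𝔤, h, 𝔞 + K p)` is a Lefschetz triple and maximality gives `p ∈ 𝔞`; now the subspace criterion with `𝔟 = 𝔞`.
[cite: LooijengaLunts1997, §2 (2.1) p. 9 L79–L106; §1 p. 7 L78–L82 (saturated)] -/
theorem IsLefschetzTriple.isJordanLefschetzPair_of_isSaturated (T : IsLefschetzTriple K h 𝔞)
    (hsat : IsLefschetzTriple.IsSaturated K T)
    (hii : ∀ f ∈ lefschetzDuals K h 𝔞, ∀ f' ∈ lefschetzDuals K h 𝔞, ⁅f, f'⁆ = 0) : IsJordanLefschetzPair K h := by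
  refine T.isJordanLefschetzPair_of_adDegree_four_eq_bot (T.adDegree_four_eq_bot_of_lie_lie_dual_mem hii ?_)
  intro x hx f hf
  have hp : ⁅x, ⁅x, f⁆⁆ ∈ adDegree K h 2 := by
    have h1 := lie_mem_adDegree (T.le_adDegree_two hx)
      (lie_mem_adDegree (T.le_adDegree_two hx) (lefschetzDuals_subset_adDegree hf))
    rwa [show (2 : K) + (2 + -2) = 2 by norm_num] at h1
  have hT' := T.sup_span_singleton hp fun a ha ↦ T.lie_adTwo_dual_eq_zero hii hf ha hx hx
  have heq : 𝔞 ⊔ K ∙ ⁅x, ⁅x, f⁆⁆ = 𝔞 := hsat _ le_sup_left hT'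
  rw [← heq]
  exact Submodule.mem_sup_right (Submodule.mem_span_singleton_self _)

/-- The same with the conclusion `𝔤₄ = 0`. [cite: LooijengaLunts1997, §2 (2.1) p. 9 L79–L106] -/
theorem IsLefschetzTriple.adDegree_four_eq_bot_of_isSaturated (T : IsLefschetzTriple K h 𝔞)
    (hsat : IsLefschetzTriple.IsSaturated K T)
    (hii : ∀ f ∈ lefschetzDuals K h 𝔞, ∀ f' ∈ lefschetzDuals K h 𝔞, ⁅f, f'⁆ = 0) : adDegree K h 4 = ⊥ :=
  T.isJordanLefschetzPair_iff.1 (T.isJordanLefschetzPair_of_isSaturated hsat hii)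

omit [CharZero K] [FiniteDimensional K L] in
/-- **Saturated ⟺ self-centralising in `𝔤₂`**: a Lefschetz triple `(𝔤, h, 𝔞)` is saturated ("`𝔞` maximal") iff
every `p ∈ 𝔤₂` commuting with `𝔞` lies in `𝔞` (by `sup_span_singleton`, `𝔞 + K p` is again a triple).
[cite: LooijengaLunts1997, §1 p. 7 L78–L82] -/
theorem IsLefschetzTriple.isSaturated_iff_forall_mem (T : IsLefschetzTriple K h 𝔞) :
    IsLefschetzTriple.IsSaturated K T ↔ ∀ p ∈ adDegree K h 2, (∀ a ∈ 𝔞, ⁅a, p⁆ = 0) → p ∈ 𝔞 := by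
  constructor
  · intro hsat p hp hp𝔞
    have heq : 𝔞 ⊔ K ∙ p = 𝔞 := hsat _ le_sup_left (T.sup_span_singleton hp hp𝔞)
    rw [← heq]
    exact Submodule.mem_sup_right (Submodule.mem_span_singleton_self _)
  · intro hC 𝔞' hle T'
    refine le_antisymm (fun p hp ↦ hC p (T'.le_adDegree_two hp) fun a ha ↦ T'.lie_eq_zero a (hle ha) p hp) hle

omit [CharZero K] in
/-- **Every Lefschetz triple is contained in a saturated one** (`𝔤` is finite-dimensional: take `𝔞' ⊇ 𝔞` maximal
among the abelian subspaces of `𝔤₂` giving Lefschetz triples). [cite: LooijengaLunts1997, §1 p. 7 L78–L82] -/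
theorem IsLefschetzTriple.exists_isSaturated (T : IsLefschetzTriple K h 𝔞) :
    ∃ 𝔞' : Submodule K L, ∃ T' : IsLefschetzTriple K h 𝔞', 𝔞 ≤ 𝔞' ∧ IsLefschetzTriple.IsSaturated K T' := by
  set S : Set (Submodule K L) := {𝔞' | 𝔞 ≤ 𝔞' ∧ IsLefschetzTriple K h 𝔞'} with hS
  obtain ⟨M, ⟨hM, TM⟩, hmax⟩ := set_has_maximal_iff_noetherian.2 (inferInstance : IsNoetherian K L) S ⟨𝔞, le_rfl, T⟩
  refine ⟨M, TM, hM, fun 𝔞' hle T' ↦ ?_⟩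
  by_contra hne
  exact hmax 𝔞' ⟨hM.trans hle, T'⟩ (lt_of_le_of_ne hle (Ne.symm hne))

/-- **(2.1) for Lefschetz PAIRS.  A Lefschetz pair `(𝔤, h)` is Jordan–Lefschetz iff some (equivalently: every)
SATURATED associated triple `(𝔤, h, 𝔞)` has mutually commuting partners `f_a`, `a ∈ dom f`** — (⟸) is the
saturated case above; (⟹): a Jordan–Lefschetz pair has the saturated triple `(𝔤, h, 𝔤₂)` (p. 9 L110–L111) and
`𝔤₋₂` abelian (A1-84). [cite: LooijengaLunts1997, §2 (2.1) p. 9 L79–L111] -/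
theorem isJordanLefschetzPair_iff_exists_isSaturated {h : L} :
    IsJordanLefschetzPair K h ↔ ∃ 𝔞 : Submodule K L, ∃ T : IsLefschetzTriple K h 𝔞,
      IsLefschetzTriple.IsSaturated K T ∧ ∀ f ∈ lefschetzDuals K h 𝔞, ∀ f' ∈ lefschetzDuals K h 𝔞, ⁅f, f'⁆ = 0 := by
  constructor
  · intro J
    exact ⟨adDegree K h 2, J.isLefschetzTriple, J.isSaturated, fun f hf f' hf' ↦ J.lie_eq_zero_of_mem_lefschetzDuals hf hf'⟩
  · rintro ⟨𝔞, T, hsat, hii⟩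
    exact T.isJordanLefschetzPair_of_isSaturated hsat hii

omit [CharZero K] [FiniteDimensional K L] in
/-- … and then EVERY saturated associated triple has commuting partners (indeed it is `(𝔤, h, 𝔤₂)`).
[cite: LooijengaLunts1997, §2 (2.1)–(2.2) p. 9 L79–L118] -/
theorem IsJordanLefschetzPair.eq_adDegree_two_of_isSaturated {h : L} (J : IsJordanLefschetzPair K h)
    (T : IsLefschetzTriple K h 𝔞) (hsat : IsLefschetzTriple.IsSaturated K T) : 𝔞 = adDegree K h 2 :=
  (hsat _ T.le_adDegree_two J.isLefschetzTriple).symm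

end Subspace

end Literature.Algebra.Lie
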